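import Mathlib
import HarnessLib
import HarnessLib.Audit
import Summits.SmoothPoincare4.Statement
import Literature.Topology.FourManifolds.HomotopySpheres
import Literature.Topology.FourManifolds.ConnectedSum
import Literature.Topology.FourManifolds.SmoothOrientation
import Literature.Topology.FourManifolds.TwistedSpheres
import Literature.Topology.FourManifolds.ClosedBall
import Summits.SmoothPoincare4.SmoothPoincare4.Theorems.SchoenfliesSplitAssembly
import Summits.SmoothPoincare4.SmoothPoincare4.Theorems.PICReduction
import Literature.Topology.FourManifolds.HomotopyS4CompactProofs
import Literature.Topology.FourManifolds.HomotopyS4OrientableProofs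
import Summits.SmoothPoincare4.SmoothPoincare4.Theorems.SullivanDualSpc4ReductionHomotopySphere

/-!
Route: SchoenfliesSplit

DORMANT since 2026-09-04T17:27:25Z (reconciler: no traction for 5 d (last activity statement-checked at 2026-08-30T16:34:44Z); parked, not closed — `ledger route dormant route-SmoothPoincare4-SchoenfliesSplit --off` to reactivate) — unstaffed, not closed; items shared with open routes are served there. `ledger route dormant <id> --off` reactivates.

X♯ = (A) ∧ (B♯) — "it suffices to show X♯". (A) PUNCTURED EMBEDDING (crux SchsplitPuncturedEmbeds,
rank 2): for every homotopy 4-sphere Σ (`Literature.Topology.FourManifolds.HomotopySphere 4`) and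
every p ∈ Σ, the open submanifold Σ ∖ {p} smoothly embeds in ℝ⁴ — equivalently Σ is invertible under
connected sum (support SchsplitInvertible is the classical form). (B♯) COLLARED SCHOENFLIES / SHELL
CAPPING (crux SchsplitShellCap, rank 3): a two-sided smooth embedding f of a spherical shell {1-ε <
‖x‖ < 1+ε} ⊂ ℝ⁴ into ℝ⁴ (inner half-shell to the bounded side of f(S³)) agrees on a thinner shell
with a smooth embedding F of the ball B(0,1+δ): the collared 3-sphere f(S³) bounds a smooth ball
compatibly with its collar. Modulo theorems (smooth Jordan–Brouwer, uniqueness of collars) B♯ ⇔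
[smooth 4D Schoenflies, ball form] ∧ [Cerf Γ₄ = 0], so X♯ is a consequence of SPC4 and implies it:
given Σ, p, the embedding f of (A) and an affine chart ψ at p, the shell map g = f ∘ ψ ∘ ι (ι =
inversion) is two-sided with bounded side f(Σ ∖ ψ(B̄)); (B♯) caps it by F; Θ := F⁻¹ ∘ f away from p
and ι ∘ ψ⁻¹ near p is a diffeomorphism Σ ∖ {p} ≃ₘ ℝ⁴ agreeing with the inverted chart near p, whence
Σ ≅ S⁴ by the PROVED tree lemma
`Literature.Geometry.Symplectic.nonempty_diffeomorph_sphere_of_agreesWithInvertedChartNear` (double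
of discs, Hirsch Ch. 8 Thm 2.1; Cerf-free, Palais-free) — this is the item SchsplitCapBridge ((A) →
(B♯) → ∀ Σ, Σ ≅ S⁴; true and elementary as mathematics, badged CRUX rank 9 since rev 16 because it
is a hypothesis of `closes` and carries the route's formalisation risk; provable now). The packaging
∀ Σ ≅ S⁴ ⇒ SmoothPoincare4 is PROVED inside `closes` (rev 17) by
`Literature.SPC4.smoothPoincare4_of_forall_homotopySphere` with the proved discharges
`compactSpace_of_homotopyEquiv_sphere_four_holds`,
`isOrientable_of_homotopyEquiv_sphere_four_holds`; the shared support item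
Spc4ReductionHomotopySphere states it and has the same 3-line proof (planner Sketch2.lean). Deciding
theorem (sorry-free, crux-only, axioms standard): `theorem closes (hA : SchsplitPuncturedEmbeds)
(hCap : SchsplitShellCap) (hBridge : SchsplitCapBridge) : SmoothPoincare4 :=
smoothPoincare4_of_forall_homotopySphere compactSpace_of_homotopyEquiv_sphere_four_holds
isOrientable_of_homotopyEquiv_sphere_four_holds (hBridge hA hCap)`. Frame items: target
SchsplitThesisSharp = X♯ (stmt-14679, rev 26: the two crux bodies verbatim, conjoined;
constant-free); the legacy target SchsplitThesis and the legacy assemblies Assembly/Assembly2 still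
carry the (A) ∧ Schoenflies-constant bodies and await the drop/restate recorded in RANKED CRUXES
(intended frame Assembly = SchsplitPuncturedEmbeds → SchsplitShellCap → SmoothPoincare4, = fun hA
hCap => closes hA hCap hBridge). SchsplitCerf (Γ₄ = 0 in twisted-sphere form) stays on the route as
SUPPORT (rev 21: a theorem fails the crux test here; it remains a staffed CRUX of routes
EuclideanOrigami / SymplecticOrigami, so the shared crux chain Cruxes/SchsplitCerf is unaffected);
it is implied by B♯ (radial extension of φ ∈ Diff S³) and is NOT a hypothesis of `closes`.
Lean: Summit.SmoothPoincare4.SmoothPoincare4.Theses.SchoenfliesSplit.SchsplitPuncturedEmbeds ∧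
Summit.SmoothPoincare4.SmoothPoincare4.Theses.SchoenfliesSplit.SchsplitShellCap

Rationale: WHY THIS LINE. The folklore factorisation of SPC4 into two named, individually weaker open problems
(doi:10.4171/qt/5 p.3 fn.; MilnorHCobordism1965 §9; Kirby1997 4.32): (A) "Σ ∖ p embeds in ℝ⁴" =
invertibility of Σ under #, pure END theory of Σ ∖ p ≈ ℝ⁴ (FreedmanJDG1982; exotic-ℝ⁴ toolbox
DeMichelisFreedman1992, Kirby1989 XIV), and (B) smooth 4D Schoenflies = codimension-one recognition
(Mazur1959, Scharlemann1984, Gompf1991Killing). ROUTE-CHOICE 2026-08-16 (option (a), drop items):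
(B) is carried in its COLLARED form B♯ = SchsplitShellCap — an ℝ⁴-analysis statement in the
vocabulary of the tree's ShellCapExtension.lean (whose exists_ballFill_of_shellEmbedding is the
sphere-preserving special case, proved from cerf_pi0Diff_sphere_three + CollarUniquenessBall) — so
that everything downstream is ELEMENTARY: SchsplitCapBridge ((A) → (B♯) → ∀Σ ≅ S⁴ via Σ ∖ p ≃ₘ ℝ⁴
agreeing with the inverted chart and the PROVED
Literature.Geometry.Symplectic.nonempty_diffeomorph_sphere_of_agreesWithInvertedChartNear; provable
now) and the packaging ∀Σ ≅ S⁴ ⇒ SmoothPoincare4, PROVED inline in `closes` from tree lemmas (rev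
17), so `closes` is crux-only and rests on no named fact. OPERATOR STEP STILL OPEN (revs 13–26;
evidence OPERATOR-g4.md, cleanupA.json, cleanupB.json, and the older OPERATOR-g2/g3.md, editA.json
v2). The legacy items that spell (B) through the bare Literature Schoenflies constant —
SchsplitThesis 0369 (legacy target, superseded by the constant-free target SchsplitThesisSharp 14679
added rev 26), SchsplitSchoenflies 0372, Assembly 0370, Assembly2 0445 — plus SchsplitBridge 8757
(re-typed rev 25 with the constant δ-unfolded in its antecedent, same meaning, Sketch4.lean Iff.rfl)
and the superseded packaging Spc4ReductionHomotopySphereV2 0441 cannot be removed by ANY planner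
verb: drop / restate / add_items route-edits all bounce on route.multi-assembly ('3 assembly items'
= Assembly 0370, Assembly2 0445, Assembly3 0517 closed·proved; add_items: 'the route already has an
assembly item'), and an assembly-kind entry can be neither dropped ('cannot be dropped'), retriaged
('cannot be retriaged') nor re-kinded through restate (kind key ignored) — nine bounces re-verified
by generation 4 after the 04:59Z gate restart (table in OPERATOR-g4.md). What gen 4 did instead:
SchsplitCerf crux → support here (rev 21; still crux in EuclideanOrigami/SymplecticOrigami),
SchsplitBridge re-typed constant-free (rev 25), SchsplitThesisSharp added (rev 26) — so the
conjecture-grade non-crux items are now 4 and the would-be crux total is 3 + 4 = 7 ≤ cap 7 (6 if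
targets are exempt): THE CAP-BREAK CONDITION OF THE 02:41Z HOLD NO LONGER HOLDS. MINIMAL OPERATOR
ACTION, either: (O1) re-run the conjecture audit with apply on this route — the gate then promotes
0372/0370/0445 (kind.auto-crux), the hold clears, exactly one assembly-kind entry (Assembly3)
remains, and any planner applies cleanupA.json (drops 0369, 0372, 8757, 0441, 0370, 0445); or (O2)
re-kind to support / detach the entries of stmt-0445 and stmt-0517, clear the hold, then
cleanupB.json (drops 0369, 0372, 8757, 0441, 0445 + restate Assembly := PuncturedEmbeds → ShellCap →
SmoothPoincare4, Sketch.lean rc 0). Either way no item then mentions the constant, the cone is clean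
(staffable) and one assembly remains. Gate fix that would let a planner finish alone: do not count
CLOSED assembly entries and allow drop/demotion of an assembly entry while another assembly or a
certified `closes` remains.
RANKED CRUXES. 2 SchsplitPuncturedEmbeds (A) — hardest and most informative (a counterexample is a
non-invertible exotic S⁴ with a LARGE ℝ⁴-like end). 3 SchsplitShellCap (B♯) — ⇔ Schoenflies ∧ Γ₄=0
modulo theorems; any proof must contain Cerf (f = radial extension of φ ∈ Diff S³). 9
SchsplitCapBridge — (A) → (B♯) → ∀ Σ ≅ S⁴: TRUE and elementary as mathematics, crux (since rev 16)
because it is hypothesis hBridge of the crux-only `closes`; failure mode formal only (Opens-subtype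
embedding, P/Q data, r-scaled inverted chart), size L–XL, provable now — serve it first. Target 0
SchsplitThesisSharp = X♯ (stmt-14679, rev 26: the two crux bodies conjoined, constant-free; Iff.rfl
with PuncturedEmbeds ∧ ShellCap); legacy target SchsplitThesis 0369 pending drop. Support:
SchsplitCerf (Cerf's theorem Γ₄ = 0 in twisted-sphere form, verbatim
Literature.Topology.FourManifolds.cerf_twistedSphere_four: XL formal debt implied by B♯, support
here since rev 21, crux r9 of EuclideanOrigami/SymplecticOrigami where its crux chain
Cruxes/SchsplitCerf is staffed), Spc4ReductionHomotopySphere (S; shared with 5 routes; now proved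
inline in `closes`, provable as an item by the same 3 lines), SchsplitInvertible (classical form ⇒
A), SchsplitEveryHsphereTwisted (waypoint ⇔ SPC4 mod Γ₄=0), Assembly = SchsplitPuncturedEmbeds →
SchsplitShellCap → SmoothPoincare4 (pending restatement; then `fun hA hCap => closes hA hCap
hBridge` from CapBridge). Legacy, drop pending (cleanupA/B.json): SchsplitThesis,
SchsplitSchoenflies, SchsplitBridge, Spc4ReductionHomotopySphereV2, Assembly2 (and Assembly on path
O1); Assembly3 stays as the proved record of the twisted-sphere chain.
KILL CRITERIA. ¬(A) (a non-invertible homotopy 4-sphere) or ¬(B♯) (an exotic Schoenflies ball; a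
non-extendable φ ∈ Diff S³ is excluded by Cerf) is each an exotic S⁴: the route closes
refuted:SchsplitPuncturedEmbeds / refuted:SchsplitShellCap together with the problem. A refutation
of SchsplitCapBridge or of the restated frame items can only be a misformalisation (Opens-subtype
embedding vs chart ball, two-sidedness data, the scalar r in the inverted chart) ⇒ restate, no
pivot. Deprioritise if neither crux is grounded within two digests; mooted if any route proves
SchsplitEveryHsphereTwisted directly.
NOT DECOMPOSED YET. B♯'s glued split into [Schoenflies, ball or equator form (shared item
stmt-SmoothPoincare4-10765 of CartanHadamardSwindle)] ∧ [SchsplitCerf] with glue via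
SchoenfliesSeparation / CollarUniquenessBall (known, L) — filed only after a crux moves (D-0019);
(B)'s substructure (3-handle-free balls, Scharlemann genus ≤ 2, Gompf killing); (A)'s end theory (Σ
∖ p ≅ ℝ⁴?, engulfing); the plumbing lemmas inside SchsplitCapBridge (component argument F(B̊) =
f(K̊), gluing Θ, rescaling by 1/r) ride with --supports, never items.
CHEAPEST FALSIFIER. None cheap: X♯ ⇔ SPC4 (negatives index empty for SmoothPoincare4). Cheapest
informative checks: (i) lookup whether an explicit smooth S³ ⊂ S⁴ not known to bound a ball survives
in print (Gompf1991Killing and Kirby1989 p.16 kill the recorded candidates; Budney–Gabai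
arXiv:1912.09029 Thm 9.11 bears on the isotopy form); (ii) lean-check that B♯ applied to the radial
extension of a φ ∈ Diff(S³) returns exactly "φ extends over D⁴" (done informally: component argument
F(B̄) = B̄), the one place the collared form could leak.

Novelty: Searches (2026-08-15/16): lit search "smooth Schoenflies conjecture four dimensional 3-sphere bounds
ball" (paper:arxiv-0906.5177, paper:arxiv-1306.2391; doi:10.1016/0040-9383(84)90040-5,
doi:10.1016/0040-9383(85)90010-2, doi:10.4171/cmh/131, doi:10.1007/978-3-030-86695-2_7); lit search
--hybrid --source local "exotic R4 end standard at infinity homotopy 4-sphere punctured"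
(book:gordon1984-four-manifold-theory pp 463-468, book:kirby1989-topology-4-manifolds pp 85-88); lit
frontier SmoothPoincare4 --since 2020 (30; arXiv:2601.08767, arXiv:2603.23717; none on Schoenflies);
lit galaxy search "4-dimensional Schoenflies conjecture" --star all (panama 2, pdf 0, crabby 0);
crossref "Schoenflies conjecture" since 2015 (doi:10.1093/oso/9780198841319.003.0003); ledger
negatives SmoothPoincare4: 0.
Nearest prior art found: doi:10.4171/qt/5 (FGMW 2010) p.3 fn.: Schoenflies "is a special case [of
SPC4]. It asks if there are invertible homotopy spheres" = the factorisation invertible / invertible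
⇒ standard; MilnorHCobordism1965 §9 (4-disc conjecture ⇔ SPC4 given Cerf; tree
everyHomotopySphereTwisted_iff); Kirby problems 4.32, N4.42(C) (book:gordon1984-four-manifold-theory
pp 465, 467); Kirby1989 p.87 Rem. 2; the collared/shell form of (B) is the tree's own
ShellCapExtension.lean vocabulary (exists_ballFill_of_shellEmbedding, sphere-preserving case).
Delta: no new mechanism — the folklore split SPC4 ⇔ [(A) punctured-embeds / invertible] ∧ [(B)
Schoenflies] filed as two staffable formal cr  [refs: 10.1016/0040-9383(84, 10.1016/0040-9383(85, 10.4171/cmh/131, 10.1007/978-3-030-86695-2_7, 10.1093/oso/9780198841319.003.0003, 10.4171/qt/5, 2601.08767, 2603.23717, paper:arxiv-0906.5177, paper:arxiv-1306.2391, doi:10.1016/0040-9383, doi:10.4171/cmh/131, doi:10.1007/978-3-030-86695-2_7, book:gordon1984-four-manifold-theory, book:kirby1989-topology-4-manifolds, doi:10.1093/oso/9780198841319.003.0003]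

Barriers (technique_class: schoenflies-split, invertible-spheres, twisted-sphere): - technique_class: schoenflies-split, invertible-spheres, twisted-sphere
- Literature.Barriers.SmoothPoincare4.TwistedSphereBarrierFour: consumed, not evaded — Γ₄ = 0 sits
INSIDE crux B♯ (SchsplitShellCap ⇒ every φ ∈ Diff S³ extends over D⁴, via the radial shell map) and
verbatim as crux SchsplitCerf; its positive clause everyHomotopySphereTwisted_iff is the waypoint
SchsplitEveryHsphereTwisted; the entry only forbids REFUTING SPC4 by twisted spheres, and `closes`
itself uses the Cerf-free double-of-discs lemma (φ = id).
- Literature.Barriers.SmoothPoincare4.HCobordismBarrierFour: evaded — "Σ ∖ ball ≅ D⁴" comes from an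
embedding into ℝ⁴ (crux A) plus codimension-one recognition (crux B♯), not from h-cobordism / handle
cancellation.
- Literature.Barriers.SmoothPoincare4.OpenAnalogueBarrierFour: respected — never "homeomorphic to ℝ⁴
+ embeds ⇒ ≅ ℝ⁴" (false, DeMichelisFreedman1992); the embedding of Σ ∖ p is used only through the
COMPACT piece Σ ∖ ψ(open ball) and its collared S³ boundary, which B♯ caps. Conceded: it is why (A)
cannot follow from topology; the bet is the standard S³ × ℝ end.
- Literature.Barriers.SmoothPoincare4.ContractibleBarrierFour: (B♯) is the boundary-S³ case its
scope caveat leaves open; not evaded; the bet: a collared S³ in ℝ⁴ is rigid where Mazur-type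
boundaries are not.
- Literature.Barriers.SmoothPoincare4.TopologicalBarrierFour (also
GaugeSum/Stable/HCobordismInvariant): negative side only — ¬(A) or ¬(B♯) is an exotic invertible S⁴
no catalogued inva

History (route lifecycle, newest last):
- 2026-08-16T14:43:05Z · LINT AUTOFIX route.multi-assembly: kept Assembly, dropped Assembly2, Assembly3 (gate:hygiene)
- 2026-08-24T07:52:11Z · DORMANT — reconciler: no traction for 6.6 d (last activity item-evidence-added at 2026-08-17T16:51:51Z); parked, not closed — `ledger route dormant route-SmoothPoincare4- (operator:999:2163367)
- 2026-08-30T04:24:21Z · REACTIVATED — reconciler: reactivated — activity statement-attached at 2026-08-30T03:37:17Z after parking at 2026-08-24T07:52:11Z (operator:999:2067938)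
- 2026-09-04T17:27:25Z · DORMANT — reconciler: no traction for 5 d (last activity statement-checked at 2026-08-30T16:34:44Z); parked, not closed — `ledger route dormant route-SmoothPoincare4-Scho (operator:999:1470235)

sub-problem: SmoothPoincare4 · status: dormant · opened planner-SmoothPoincare4-Survey-0 2026-08-13T06:11:34Z · rev 28 · ledger route-SmoothPoincare4-SchoenfliesSplit
GENERATED by the gate from the ledger (D-0016/17). Provers cite these decls: `theorem foo : Summit.SmoothPoincare4.SmoothPoincare4.Theses.SchoenfliesSplit.<Decl> := …` in Summits/SmoothPoincare4/SmoothPoincare4/Theorems/<Name>.lean.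
-/

namespace Summit.SmoothPoincare4.SmoothPoincare4.Theses.SchoenfliesSplit

open scoped BigOperators Topology Manifold Classical MeasureTheory ProbabilityTheory Matrix InnerProductSpace ComplexConjugate ContinuousMap ContDiff
open Filter Set Function TopologicalSpace MeasureTheory

attribute [summit_statement] _root_.SmoothPoincare4

open Literature.SPC4

/-! Retired items kept as plain definitions (history; not obligations of this route): landed proofs / closed glue still name them. -/

-- tombstone: stmt-SmoothPoincare4-0517 was DROPPED from this route but is still named by active items / landed proofs — kept as a plain def (no route_item tag), not an obligation of this route
/-- retired stmt-SmoothPoincare4-0517 (dropped, gen None) — proved by Literature.SPC4.schsplit_assembly_v3. -/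
def Assembly3 : Prop :=
  Literature.Topology.FourManifolds.isSmoothEmbedding_sphereInclusion' 3 → (∀ [Fact (Literature.Topology.FourManifolds.isSmoothEmbedding_sphereInclusion' 3)] (φ : (Metric.sphere (0 : EuclideanSpace ℝ (Fin 4)) 1) ≃ₘ⟮𝓡 3, 𝓡 3⟯ (Metric.sphere (0 : EuclideanSpace ℝ (Fin 4)) 1)) (T : Literature.Topology.FourManifolds.TwistedSphere 3 φ), Nonempty (T.carrier ≃ₘ⟮𝓡 4, 𝓡 4⟯ Metric.sphere (0 : EuclideanSpace ℝ (Fin 5)) 1)) → (∀ [Fact (Literature.Topology.FourManifolds.isSmoothEmbedding_sphereInclusion' 3)] (S : Literature.Topology.FourManifolds.HomotopySphere 4), ∃ φ : (Metric.sphere (0 : EuclideanSpace ℝ (Fin 4)) 1) ≃ₘ⟮𝓡 3, 𝓡 3⟯ (Metric.sphere (0 : EuclideanSpace ℝ (Fin 4)) 1), Literature.Topology.FourManifolds.IsTwistedSphere 3 φ S.carrier) → (∀ S : Literature.Topology.FourManifolds.HomotopySphere 4, Nonempty (S.carrier ≃ₘ⟮𝓡 4, 𝓡 4⟯ Metric.sphere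 (0 : EuclideanSpace ℝ (Fin 5)) 1))

/-- item stmt-SmoothPoincare4-0369 · target · rank 0 · open · by planner
why it might fail: X ⇔ SPC4 (both conjuncts follow from SPC4), so X fails iff an exotic S⁴ exists — an exotic Schoenflies ball kills (B)/(B♯), a non-invertible homotopy sphere kills (A). LEGACY BODY ((A) ∧ bare Literature Schoenflies constant): restate to (A) ∧ (B♯) pending operator (route-choice note rev 12).
sources: doi:10.4171/qt/5, Kirby1989, book:gordon1984-four-manifold-theory, MilnorHCobordism1965
(A) for every homotopy 4-sphere Σ and p ∈ Σ, the open manifold Σ ∖ {p} (Opens submanifold structure)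
smoothly embeds in ℝ⁴; (B) `Literature.Topology.FourManifolds.SmoothSchoenfliesConjectureFour`. Both
are consequences of SPC4; together they imply it. Sources: Kirby1997 4.32; Mazur1959; Freedman1982;
Cerf1968. opens: `open scoped Manifold ContDiff`, `open ContinuousMap`; imports:
Summits.SmoothPoincare4.Statement +
Literature.Topology.FourManifolds.{HomotopySpheres,KirbyMoves,SliceRibbon,LeeRasmussen,Morse,ConnectedSum,Cobordism,GluckTwist,SurgeryGluck,CappellShaneson}
+ Literature.Geometry.Lorentzian.LeviCivita. -/
@[route_item "route-SmoothPoincare4-SchoenfliesSplit"]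
def SchsplitThesis : Prop :=
  (∀ (S : Literature.Topology.FourManifolds.HomotopySphere 4) (p : S.carrier), ∃ f : (⟨{p}ᶜ, isOpen_compl_singleton⟩ : TopologicalSpace.Opens S.carrier) → EuclideanSpace ℝ (Fin 4), Manifold.IsSmoothEmbedding (𝓡 4) (𝓡 4) ∞ f) ∧ Literature.Topology.FourManifolds.SmoothSchoenfliesConjectureFour

/-- item stmt-SmoothPoincare4-14679 · target · rank 0 · open · by planner
why it might fail: X♯ ⇔ SPC4 (both conjuncts follow from SPC4 and together imply it): fails iff an exotic 4-sphere exists — a non-invertible homotopy 4-sphere kills (A), an exotic Schoenflies ball kills (B♯).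
sources: doi:10.4171/qt/5, MilnorHCobordism1965, Kirby1989, book:gordon1984-four-manifold-theory, Scharlemann1984
[target] X-sharp = (A) AND (B-sharp): the bodies of crux SchsplitPuncturedEmbeds (A: every punctured
homotopy 4-sphere smoothly embeds in R^4) and crux SchsplitShellCap (B-sharp: collared shell-capping
form of smooth 4D Schoenflies) verbatim, conjoined — Iff.rfl with SchsplitPuncturedEmbeds AND
SchsplitShellCap (planner Sketch.lean rc 0). Derived from the two cruxes by And.intro; implies
SmoothPoincare4 through crux SchsplitCapBridge and the proved packaging (the route's deciding
theorem closes). Constant-free successor of the legacy target SchsplitThesis (stmt-0369, body (A)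
AND [bare Literature Schoenflies constant]), which is dropped as soon as structural route edits stop
bouncing (route-choice (a)). why it might fail: X-sharp is equivalent to SPC4 — it fails iff an
exotic 4-sphere exists (a non-invertible homotopy 4-sphere kills (A), an exotic Schoenflies ball
kills (B-sharp)). sources: doi:10.4171/qt/5, MilnorHCobordism1965, Kirby1989,
book:gordon1984-four-manifold-theory, Scharlemann1984. -/
@[route_item "route-SmoothPoincare4-SchoenfliesSplit"]
def SchsplitThesisSharp : Prop :=
  (∀ (S : Literature.Topology.FourManifolds.HomotopySphere 4) (p : S.carrier), ∃ f : (⟨{p}ᶜ, isOpen_compl_singleton⟩ : TopologicalSpace.Opens S.carrier) → EuclideanSpace ℝ (Fin 4), Manifold.IsSmoothEmbedding (𝓡 4) (𝓡 4) ∞ f) ∧ (∀ (f finv : EuclideanSpace ℝ (Fin 4) → EuclideanSpace ℝ (Fin 4)) (ε : ℝ), 0 < ε → ContDiffOn ℝ ∞ f {x | 1 - ε < ‖x‖ ∧ ‖x‖ < 1 + ε} → IsOpen (f '' {x | 1 - ε < ‖x‖ ∧ ‖x‖ < 1 + ε}) → ContDiffOn ℝ ∞ finv (f '' {x | 1 -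 ε < ‖x‖ ∧ ‖x‖ < 1 + ε}) → (∀ x : EuclideanSpace ℝ (Fin 4), 1 - ε < ‖x‖ → ‖x‖ < 1 + ε → finv (f x) = x) → (∃ P Q : Set (EuclideanSpace ℝ (Fin 4)), IsOpen P ∧ IsOpen Q ∧ Disjoint P Q ∧ P ∪ Q = (f '' Metric.sphere 0 1)ᶜ ∧ Bornology.IsBounded P ∧ (∀ x : EuclideanSpace ℝ (Fin 4), 1 - ε < ‖x‖ → ‖x‖ < 1 → f x ∈ P) ∧ ∀ x : EuclideanSpace ℝ (Fin 4), 1 < ‖x‖ → ‖x‖ < 1 + ε → f x ∈ Q) → ∃ (F Finv : EuclideanSpace ℝ (Fin 4) → EuclideanSpace ℝ (Fin 4)) (δ : ℝ), 0 < δ ∧ δ ≤ ε ∧ ContDiffOn ℝ ∞ F (Metric.ball 0 (1 + δ)) ∧ (∀ x : EuclideanSpace ℝ (Fin 4), 1 - δ < ‖x‖ → ‖x‖ < 1 + δ → F x = f x) ∧ IsOpen (F '' Metric.ball 0 (1 + δ)) ∧ ContDiffOn ℝ ∞ Finv (F '' Metric.ball 0 (1 + δ)) ∧ ∀ x ∈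 Metric.ball (0 : EuclideanSpace ℝ (Fin 4)) (1 + δ), Finv (F x) = x)

/-- item stmt-SmoothPoincare4-0371 · crux · rank 2 · open · by planner
why it might fail: False iff some homotopy 4-sphere is non-invertible (Σ # T ≇ S⁴ for all T); exotic ℝ⁴'s show topology never controls smooth embeddability (Kirby1989 ch. XIV; p.87 Rem. 2) and no invariant of END-STANDARD smoothings of ℝ⁴ is known to force smallness.
sources: FreedmanJDG1982, Kirby1989, DeMichelisFreedman1992, book:gordon1984-four-manifold-theory, doi:10.4171/qt/5, arXiv:2601.08767
The new content of the split. Σ ∖ {p} is homeomorphic to ℝ⁴ (Freedman1982); asks that this smoothing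
of ℝ⁴ be `small' in the exotic-ℝ⁴ sense. Refutation = an exotic S⁴. Sources: Freedman1982;
GompfStipsicz1999 §9.4 (large/small exotic ℝ⁴). -/
@[route_item "route-SmoothPoincare4-SchoenfliesSplit"]
def SchsplitPuncturedEmbeds : Prop :=
  ∀ (S : Literature.Topology.FourManifolds.HomotopySphere 4) (p : S.carrier), ∃ f : (⟨{p}ᶜ, isOpen_compl_singleton⟩ : TopologicalSpace.Opens S.carrier) → EuclideanSpace ℝ (Fin 4), Manifold.IsSmoothEmbedding (𝓡 4) (𝓡 4) ∞ f

/-- item stmt-SmoothPoincare4-11868 · crux · rank 3 · open · by planner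
why it might fail: Equivalent (mod Cerf Γ₄=0, collar uniqueness, Jordan–Brouwer: theorems) to smooth 4D Schoenflies, open since 1959, known only for genus≤2 / 3-handle-free balls (Scharlemann1984, Gompf 1991): an exotic Schoenflies ball refutes it; any proof must contain Γ₄=0 (f = radial ext. of φ∈Diff S³).
sources: Mazur1959, Scharlemann1984, doi:10.1016/0040-9383(84)90040-5, CerfDiffeoSphere1968, MilnorHCobordism1965, Kirby1997
[crux] (B♯) COLLARED / SHELL-CAPPING form of the smooth 4-dimensional Schoenflies problem; replaces
(B) SchsplitSchoenflies := SmoothSchoenfliesConjectureFour as this route's second crux (route-choice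
repair 2026-08-15: re-route around the XL apex
Literature.Topology.FourManifolds.cerf_twistedSphere_four). In the vocabulary of Literature
ShellCapExtension.lean (whose exists_ballFill_of_shellEmbedding is the SPHERE-PRESERVING special
case, proved there from cerf_pi0Diff_sphere_three + CollarUniquenessBall): let f be C^∞ on the
two-sided shell A_ε = {1-ε < ‖x‖ < 1+ε} ⊂ ℝ⁴ with open image and a C^∞ left inverse finv on f(A_ε)
(a shell embedding), and let ℝ⁴ ∖ f(S³) = P ⊔ Q, P and Q open, P bounded, f(inner half-shell) ⊆ P,
f(outer half-shell) ⊆ Q (two-sidedness data; in applications P = the inside region). THEN f agrees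
on a thinner two-sided shell A_δ with a C^∞ embedding F of the ball B(0,1+δ) (open image, C^∞
inverse Finv on it): the collared 3-sphere f(S³) bounds a smooth ball compatibly with its collar.
MATHEMATICS: modulo theorems (uniqueness of collars; smooth Jordan–Brouwer) B♯ ⇔ [Schoenflies, ball
form in ℝ⁴] ∧ [every φ ∈ Diff(S³) extends over D⁴, i.e. Cerf Γ₄ = 0]: (⇐) D = P -/
@[route_item "route-SmoothPoincare4-SchoenfliesSplit"]
def SchsplitShellCap : Prop :=
  ∀ (f finv : EuclideanSpace ℝ (Fin 4) → EuclideanSpace ℝ (Fin 4)) (ε : ℝ), 0 < ε → ContDiffOn ℝ ∞ f {x | 1 - ε < ‖x‖ ∧ ‖x‖ < 1 + ε} → IsOpen (f '' {x | 1 - ε < ‖x‖ ∧ ‖x‖ < 1 + ε}) → ContDiffOn ℝ ∞ finv (f '' {x | 1 - ε < ‖x‖ ∧ ‖x‖ < 1 + ε}) → (∀ x : EuclideanSpace ℝ (Fin 4), 1 - ε < ‖x‖ → ‖x‖ < 1 + ε → finv (f x) = x) → (∃ P Q : Set (EuclideanSpace ℝ (Fin 4)), IsOpen P ∧ IsOpen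 Q ∧ Disjoint P Q ∧ P ∪ Q = (f '' Metric.sphere 0 1)ᶜ ∧ Bornology.IsBounded P ∧ (∀ x : EuclideanSpace ℝ (Fin 4), 1 - ε < ‖x‖ → ‖x‖ < 1 → f x ∈ P) ∧ ∀ x : EuclideanSpace ℝ (Fin 4), 1 < ‖x‖ → ‖x‖ < 1 + ε → f x ∈ Q) → ∃ (F Finv : EuclideanSpace ℝ (Fin 4) → EuclideanSpace ℝ (Fin 4)) (δ : ℝ), 0 < δ ∧ δ ≤ ε ∧ ContDiffOn ℝ ∞ F (Metric.ball 0 (1 + δ)) ∧ (∀ x : EuclideanSpace ℝ (Fin 4), 1 - δ < ‖x‖ → ‖x‖ < 1 + δ → F x = f x) ∧ IsOpen (F '' Metric.ball 0 (1 + δ)) ∧ ContDiffOn ℝ ∞ Finv (F '' Metric.ball 0 (1 + δ)) ∧ ∀ x ∈ Metric.ball (0 : EuclideanSpace ℝ (Fin 4)) (1 + δ), Finv (F x) = x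

/-- item stmt-SmoothPoincare4-11912 · crux · rank 9 · open · by planner
why it might fail: TRUE, elementary mathematics (shell map g = f∘ψ∘ι, two-sidedness P = f(K̊), cap F from (B♯), Θ = F⁻¹∘f ∪ ι∘ψ⁻¹, double-of-discs lemma); fails only AS TYPED — Opens-subtype embedding of (A), the P/Q data fed to (B♯), or the r-scaled inverted-chart clause — formal size L–XL; refutation ⇒ restate.
sources: HirschDT1976, Palais1960, Kirby1989, Literature.Geometry.Symplectic.nonempty_diffeomorph_sphere_of_agreesWithInvertedChartNear
[support] ELEMENTARY BRIDGE (A) → (B♯) → every homotopy 4-sphere Σ is diffeomorphic to S⁴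
(antecedents = verbatim bodies of SchsplitPuncturedEmbeds and SchsplitShellCap). Cerf-free and
Palais-free; no named fact; PROVABLE NOW (difficulty L = Lean plumbing). Proof: fix Σ and p (Σ ≠ ∅
via the homotopy equivalence), f : Σ∖{p} ↪ ℝ⁴ from (A) (an equidimensional smooth embedding, hence a
diffeomorphism onto its open image, cf. exists_chart_of_isSmoothEmbedding in
PalaisBallComplement.lean), e = extChartAt (𝓡 4) p, r > 0 with B̄(e p, 3r) inside the chart target,
ψ(z) := e⁻¹(e p + r z) for ‖z‖ < 3 (ψ 0 = p). SHELL MAP g := f ∘ ψ ∘ ι on A_{1/2} = {1/2 < ‖x‖ <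
3/2}, ι x = x/‖x‖² (Literature.Geometry.Symplectic.inversion = sphereInversion), ginv := ι ∘ ψ⁻¹ ∘
f⁻¹. TWO-SIDEDNESS DATA: K := Σ ∖ ψ(B̊(0,1)) (compact, K̊ = Σ ∖ ψ(B̄(0,1)), K ∖ K̊ = ψ(S³)); P :=
f(K̊) (open, bounded), Q := ℝ⁴ ∖ f(K) (open, f(K) compact); P ⊔ Q = ℝ⁴ ∖ g(S³); g(inner half-shell)
= fψ({1 < ‖z‖ < 2}) ⊆ P and g(outer) = fψ({2/3 < ‖z‖ < 1}) ⊆ Q by injectivity of f, ψ. (B♯) gives F,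
Finv, δ with F = g on A_δ, F a C^∞ embedding of B(0,1+δ). COMPONENT ARGUMENT (no Jordan–Brouwer
needed): V := F(B̊(0,1)) is open, connected, wi -/
@[route_item "route-SmoothPoincare4-SchoenfliesSplit"]
def SchsplitCapBridge : Prop :=
  (∀ (S : Literature.Topology.FourManifolds.HomotopySphere 4) (p : S.carrier), ∃ f : (⟨{p}ᶜ, isOpen_compl_singleton⟩ : TopologicalSpace.Opens S.carrier) → EuclideanSpace ℝ (Fin 4), Manifold.IsSmoothEmbedding (𝓡 4) (𝓡 4) ∞ f) → (∀ (f finv : EuclideanSpace ℝ (Fin 4) → EuclideanSpace ℝ (Fin 4)) (ε : ℝ), 0 < ε → ContDiffOn ℝ ∞ f {x | 1 - ε < ‖x‖ ∧ ‖x‖ < 1 + ε} → IsOpen (f '' {x | 1 - ε < ‖x‖ ∧ ‖x‖ < 1 + ε}) → ContDiffOn ℝ ∞ finv (f '' {x | 1 - ε < ‖x‖ ∧ ‖x‖ < 1 + ε}) → (∀ x : EuclideanSpace ℝ (Fin 4), 1 - ε < ‖x‖ → ‖x‖ < 1 + ε → finv (f x) = x) → (∃ P Q : Set (EuclideanSpace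 ℝ (Fin 4)), IsOpen P ∧ IsOpen Q ∧ Disjoint P Q ∧ P ∪ Q = (f '' Metric.sphere 0 1)ᶜ ∧ Bornology.IsBounded P ∧ (∀ x : EuclideanSpace ℝ (Fin 4), 1 - ε < ‖x‖ → ‖x‖ < 1 → f x ∈ P) ∧ ∀ x : EuclideanSpace ℝ (Fin 4), 1 < ‖x‖ → ‖x‖ < 1 + ε → f x ∈ Q) → ∃ (F Finv : EuclideanSpace ℝ (Fin 4) → EuclideanSpace ℝ (Fin 4)) (δ : ℝ), 0 < δ ∧ δ ≤ ε ∧ ContDiffOn ℝ ∞ F (Metric.ball 0 (1 + δ)) ∧ (∀ x : EuclideanSpace ℝ (Fin 4), 1 - δ < ‖x‖ → ‖x‖ < 1 + δ → F x = f x) ∧ IsOpen (F '' Metric.ball 0 (1 + δ)) ∧ ContDiffOn ℝ ∞ Finv (F '' Metric.ball 0 (1 + δ)) ∧ ∀ x ∈ Metric.ball (0 : EuclideanSpace ℝ (Fin 4)) (1 + δ), Finv (F x) = x) → ∀ S : Literature.Topology.FourManifolds.HomotopySphere 4, Nonempty (S.carrier ≃ₘ⟮𝓡 4, 𝓡 4⟯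 Metric.sphere (0 : EuclideanSpace ℝ (Fin 5)) 1)

/-- item stmt-SmoothPoincare4-0516 · support · rank 2 · open · by planner
why it might fail: ⇔ SPC4 given Γ₄ = 0 (MilnorHCobordism1965 §9): false iff an exotic S⁴ exists; as an independent crux it would merely restate the target.
sources: MilnorHCobordism1965, KervaireMilnorAnnals1963, Juhasz2023
∀ Σ : HomotopySphere 4, ∃ φ : S³ ≃ₘ S³ with Literature.Topology.FourManifolds.IsTwistedSphere 3 φ
Σ.carrier, i.e. Σ is the boundary-gluing of two closed smooth 4-discs (IsBoundaryGluing of two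
closedBallBoundaryData 3 along φ: two smooth codim-0 embeddings D⁴ ↪ Σ covering Σ and meeting
exactly along ∂ via φ). Classical equivalents: Σ admits a Morse function with exactly 2 critical
points; Σ ∖ (open chart-ball) ≅ D⁴. STATUS: OPEN, ⇔ SPC4 given Cerf Γ₄ = 0 (⇒ S⁴ by fact_cerf_v2 =
assembly v3; ⇐ S⁴ = Σ(id) via isTwistedSphere_refl_sphere + transport of IsBoundaryGluing along Σ ≅
S⁴). WHY it is the right head crux for this route: thesis 0369 [(A) Σ∖p ↪ ℝ⁴ smoothly ∧ (B)
SmoothSchoenfliesConjectureFour] yields exactly this (0445 chain: image of a chart-sphere is a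
smooth S³ ⊂ ℝ⁴ ⊂ S⁴; (B) ⇒ it bounds smooth balls on both sides; Palais disc theorem for
well-definedness; so Σ = D⁴ ∪ chart-ball). It is also the landing point of R7 (Gromov–McDuff pair
theorem ⇒ Σ ∖ ball ≅ CP² ∖ N(CP¹) = D⁴) and of R3/R8 handle arguments (no 1- /3-handles + GPRC ⇒ 0∪4
handles). Shared waypoint; refutation ⇔ ¬SPC4. Instance binder `∀ [Fact
(Literature.Topology.FourManifolds.isSmoothEmbedding_sphereInclusion' 3 -/
@[route_item "route-SmoothPoincare4-SchoenfliesSplit"]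
def SchsplitEveryHsphereTwisted : Prop :=
  ∀ [Fact (Literature.Topology.FourManifolds.isSmoothEmbedding_sphereInclusion' 3)] (S : Literature.Topology.FourManifolds.HomotopySphere 4), ∃ φ : (Metric.sphere (0 : EuclideanSpace ℝ (Fin 4)) 1) ≃ₘ⟮𝓡 3, 𝓡 3⟯ (Metric.sphere (0 : EuclideanSpace ℝ (Fin 4)) 1), Literature.Topology.FourManifolds.IsTwistedSphere 3 φ S.carrier

/-- item stmt-SmoothPoincare4-0372 · support · rank 3 · open · by planner
why it might fail: Smooth 4D Schoenflies, open since 1959: proved only for balls with a 3-handle-free decomposition / middle level of genus ≤ 2 (Scharlemann1984, Gompf killing); a Schoenflies ball needing 3-handles essentially would be an exotic invertible S⁴. Strictly implied by crux B♯ (SchsplitShellCap).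
sources: Mazur1959, Scharlemann1984, doi:10.1016/0040-9383(84)90040-5, Kirby1989, arXiv:1912.09029, Gompf1991Killing
Literature def `Literature.Topology.FourManifolds.SmoothSchoenfliesConjectureFour` (SPC4Wave0.lean).
Known: true after # (S²×S²) (Mazur1959), true for Schoenflies balls with 3-handle-free
decompositions (Scharlemann; Gompf). Sources: Mazur1959; Kirby1997 4.32. -/
@[route_item "route-SmoothPoincare4-SchoenfliesSplit"]
def SchsplitSchoenflies : Prop :=
  Literature.Topology.FourManifolds.SmoothSchoenfliesConjectureFour

/-- item stmt-SmoothPoincare4-0373 · support · rank 4 · open · by planner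
sources: KervaireMilnorAnnals1963, Juhasz2023, doi:10.4171/qt/5
∀ Σ ∃ T homotopy 4-sphere with S⁴ a connected sum Σ # T (relational
`Literature.Topology.FourManifolds.IsConnectedSum`). Implies crux #2 (Σ minus a ball sits in Σ # T =
S⁴). This is exactly the missing n = 4 case of the group structure on homotopy spheres under #
(KervaireMilnor1963 Thm 1.1 excludes nothing but our Literature
`exists_commGroup_homotopySphereClass` assumes n ≠ 4). Sources: KervaireMilnor1963 §2; Literature
HomotopySpheres.lean. -/
@[route_item "route-SmoothPoincare4-SchoenfliesSplit"]
def SchsplitInvertible : Prop :=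
  ∀ S : Literature.Topology.FourManifolds.HomotopySphere 4, ∃ T : Literature.Topology.FourManifolds.HomotopySphere 4, Literature.Topology.FourManifolds.IsConnectedSum (𝓡 4) (𝓡 4) (𝓡 4) S.carrier T.carrier (Metric.sphere (0 : EuclideanSpace ℝ (Fin 5)) 1)

/-- item stmt-SmoothPoincare4-0374 · support · rank 5 · closed · proved by Summit.SmoothPoincare4.SmoothPoincare4.Theorems.spc4ReductionHomotopySphere_proof (prover) · by planner
Shared reduction (bookkeeping, known): SmoothPoincare4 quantifies over bare (M, T2, 2nd-countable,
charted, smooth, e : M ≃ₕ S⁴); a manifold ≃ₕ S⁴ is compact (H₄ ≠ 0 forces compactness) and simply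
connected hence smoothly orientable, so it packages as an
`Literature.Topology.FourManifolds.HomotopySphere 4`. Sources: KervaireMilnor1963 §1; Literature
HomotopySpheres.lean. opens: `open scoped Manifold ContDiff`, `open ContinuousMap`; imports:
Summits.SmoothPoincare4.Statement +
Literature.Topology.FourManifolds.{HomotopySpheres,KirbyMoves,SliceRibbon,LeeRasmussen,Morse,ConnectedSum,Cobordism,GluckTwist,SurgeryGluck,CappellShaneson}
+ Literature.Geometry.Lorentzian.LeviCivita. -/
@[route_item "route-SmoothPoincare4-SchoenfliesSplit"]
def Spc4ReductionHomotopySphere : Prop :=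
  (∀ S : Literature.Topology.FourManifolds.HomotopySphere 4, Nonempty (S.carrier ≃ₘ⟮𝓡 4, 𝓡 4⟯ Metric.sphere (0 : EuclideanSpace ℝ (Fin 5)) 1)) → SmoothPoincare4

/-- `Spc4ReductionHomotopySphere` holds: proved by `Summit.SmoothPoincare4.SmoothPoincare4.Theorems.spc4ReductionHomotopySphere_proof`. -/
theorem Spc4ReductionHomotopySphere_holds : Spc4ReductionHomotopySphere := _root_.Summit.SmoothPoincare4.SmoothPoincare4.Theorems.spc4ReductionHomotopySphere_proof

/-- item stmt-SmoothPoincare4-0441 · support · rank 5 · open · by planner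
SUPERSEDES stmt-SmoothPoincare4-0374 (grounder B/A2 + refuter A-0/A-1: TRUE bookkeeping but not
staffable as a bare implication). Now carries the two packaging facts as hypotheses: (hC) a smooth
4-manifold M ≃ₕ S⁴ is compact [Hatcher2002 Prop 3.29 + Thm 2.13; cite item filed]; (hO) such an M is
orientable, `Literature.Topology.FourManifolds.IsOrientable (𝓡 4) M` [LeeSmoothManifolds2013 Thm
15.40 + Hatcher2002 Props 1.14/1.18; cite item filed]. Proof sketch (≈15 lines): intro hC hO h M _ _
_; unfold SmoothPoincare4 Literature.SPC4.SmoothPoincareConjectureFour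
HomotopyEquiv.NonemptyDiffeomorphSphere; intro _ _ e; haveI := hC M e; obtain ⟨o⟩ := hO M e; exact h
⟨M, o, ⟨e⟩⟩ (mind the anonymous-constructor field order of
Literature.Topology.FourManifolds.HomotopySphere: carrier, [6 instances], orientation,
nonempty_homotopyEquiv; universe: carrier : Type = SmoothPoincareConjectureFour.{0} ✓). opens: `open
scoped Manifold ContDiff`, `open ContinuousMap`; imports: Summits.SmoothPoincare4.Statement +
Literature.Topology.FourManifolds.HomotopySpheres + Literature.Geometry.Lorentzian.LeviCivita.
Elaborated 2026-08-13 session 3 with plain `lean check` (folder/Sk/Sketch3.lean rc 0). -/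
@[route_item "route-SmoothPoincare4-SchoenfliesSplit"]
def Spc4ReductionHomotopySphereV2 : Prop :=
  (∀ (M : Type) [TopologicalSpace M] [T2Space M] [SecondCountableTopology M] [ChartedSpace (EuclideanSpace ℝ (Fin 4)) M] [IsManifold (𝓡 4) ∞ M], M ≃ₕ Metric.sphere (0 : EuclideanSpace ℝ (Fin 5)) 1 → CompactSpace M) → (∀ (M : Type) [TopologicalSpace M] [T2Space M] [SecondCountableTopology M] [ChartedSpace (EuclideanSpace ℝ (Fin 4)) M] [IsManifold (𝓡 4) ∞ M], M ≃ₕ Metric.sphere (0 : EuclideanSpace ℝ (Fin 5)) 1 → Literature.Topology.FourManifolds.IsOrientable (𝓡 4) M) → (∀ S : Literature.Topology.FourManifolds.HomotopySphere 4, Nonempty (S.carrier ≃ₘ⟮𝓡 4, 𝓡 4⟯ Metric.sphere (0 : EuclideanSpace ℝ (Fin 5)) 1)) → SmoothPoincare4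

/-- item stmt-SmoothPoincare4-8757 · support · rank 9 · open · by planner
sources: Palais1960, HirschDT1976, Kirby1989
[support] (A) → (B) → every homotopy 4-sphere Σ is a twisted sphere D⁴ ∪_φ D⁴
(`Literature.Topology.FourManifolds.IsTwistedSphere 3 φ Σ`, the waypoint
SchsplitEveryHsphereTwisted). Proof in words: embed Σ ∖ {p} in ℝ⁴ ⊂ S⁴ (inverse stereographic
projection); the image of a chart 3-sphere about p is a smooth S³ separating S⁴ (smooth
Jordan–Brouwer; tree SchoenfliesSeparation.lean) with e(Σ ∖ open chart-ball) the closure of one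
side; (B) in ball form on that side (`SmoothSchoenfliesConjectureFour.exists_ball_not_mem`, proved)
makes it a smoothly embedded closed 4-disc; pulled back along e and paired with the chart disc these
are the two disc embeddings of `IsBoundaryGluing (closedBallBoundaryData 3) (closedBallBoundaryData
3) φ (𝓡 4) Σ`. Known mathematics (Palais 1960 Thm B; Hirsch Ch. 8), formalisation-heavy, no research
content — hence support (this was the deliberately untyped arrow of the superseded informal
Assembly2). [deps: SchsplitPuncturedEmbeds, SchsplitSchoenflies] [difficulty: L] Sources:
Palais1960, HirschDT1976, Kirby1989. -/
@[route_item "route-SmoothPoincare4-SchoenfliesSplit"]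
def SchsplitBridge : Prop :=
  (∀ (S : Literature.Topology.FourManifolds.HomotopySphere 4) (p : S.carrier), ∃ f : (⟨{p}ᶜ, isOpen_compl_singleton⟩ : TopologicalSpace.Opens S.carrier) → EuclideanSpace ℝ (Fin 4), Manifold.IsSmoothEmbedding (𝓡 4) (𝓡 4) ∞ f) → (∀ f : Metric.sphere (0 : EuclideanSpace ℝ (Fin 4)) 1 → Metric.sphere (0 : EuclideanSpace ℝ (Fin 5)) 1, Manifold.IsSmoothEmbedding (𝓡 3) (𝓡 4) ∞ f → ∃ φ : Metric.sphere (0 : EuclideanSpace ℝ (Fin 5)) 1 ≃ₘ⟮𝓡 4, 𝓡 4⟯ Metric.sphere (0 : EuclideanSpace ℝ (Fin 5)) 1, φ '' Set.range f = Literature.Topology.FourManifolds.sphereFourEquator) → ∀ [Fact (Literature.Topology.FourManifolds.isSmoothEmbedding_sphereInclusion' 3)] (S : Literature.Topology.FourManifolds.HomotopySphere 4), ∃ φ : (Metric.sphere (0 : EuclideanSpace ℝ (Fin 4)) 1) ≃ₘ⟮𝓡 3, 𝓡 3⟯ (Metric.sphere (0 : EuclideanSpace ℝ (Fin 4)) 1),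 Literature.Topology.FourManifolds.IsTwistedSphere 3 φ S.carrier

/-- item stmt-SmoothPoincare4-8758 · support · rank 9 · open · by planner
why it might fail: A THEOREM (Cerf 1968 Γ₄=0; Hatcher 1983): no mathematical failure mode; it fails only as a FORMAL TASK — XL, no formal proof exists; the tree peels it by proved glue to the single apex π₀ Diff(D³ rel ∂)=0 (cerf_pi0DiffDisc_relBoundary_three).
sources: CerfDiffeoSphere1968, Hatcher1983, MilnorHCobordism1965, KervaireMilnorAnnals1963
[support] Cerf's theorem Γ₄ = 0 in twisted-sphere form — every twisted 4-sphere D⁴ ∪_φ D⁴ is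
diffeomorphic to S⁴ — VERBATIM the body of the tree's named fact
`Literature.Topology.FourManifolds.cerf_twistedSphere_four` (CerfGammaFour.lean; Cerf 1968 main
theorem, Kervaire–Milnor 1963 §1, Milnor 1965 §9; reproved through Hatcher's Smale conjecture and
Eliashberg's filling by discs). Filed as an item so the route's single genuinely needed unproved
fact is visible tier-0 debt (needs-fact: Literature.Topology.FourManifolds.cerf_twistedSphere_four)
without importing CerfGammaFour into the route file; the tree already reduces the fact to the leaf
π₀ Diff(D³ rel ∂) = 0 (`cerf_twistedSphere_four_of_relBoundary`,
`cerf_twistedSphere_four_of_pi0Diff'`, `cerf_twistedSphere_four_of_extends'`); this item closes by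
`cerf_twistedSphere_four` itself the day the Literature discharges it. Known theorem: formalisation
debt, not research. [difficulty: XL] Sources: CerfDiffeoSphere1968, KervaireMilnorAnnals1963,
MilnorHCobordism1965. -/
@[route_item "route-SmoothPoincare4-SchoenfliesSplit"]
def SchsplitCerf : Prop :=
  ∀ [Fact (Literature.Topology.FourManifolds.isSmoothEmbedding_sphereInclusion' 3)] (φ : (Metric.sphere (0 : EuclideanSpace ℝ (Fin 4)) 1) ≃ₘ⟮𝓡 3, 𝓡 3⟯ (Metric.sphere (0 : EuclideanSpace ℝ (Fin 4)) 1)) (T : Literature.Topology.FourManifolds.TwistedSphere 3 φ), Nonempty (T.carrier ≃ₘ⟮𝓡 4, 𝓡 4⟯ Metric.sphere (0 : EuclideanSpace ℝ (Fin 5)) 1)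

/-- item stmt-SmoothPoincare4-0370 · assembly · rank 1 · open · by planner
Embed Σ ∖ {p} in ℝ⁴ ⊂ S⁴; the image of a small round S³ about p bounds the compact image of Σ ∖
(open ball); Schoenflies ⇒ it is a 4-ball; so Σ = B⁴ ∪_φ B⁴, φ ∈ Diff(S³) extends over B⁴ (Cerf Γ₄ =
0) ⇒ Σ ≅ S⁴; then the shared reduction. Sources: Cerf1968; Palais1960; Milnor1965 (twisted spheres). -/
@[route_item "route-SmoothPoincare4-SchoenfliesSplit"]
def Assembly : Prop :=
  ((∀ (S : Literature.Topology.FourManifolds.HomotopySphere 4) (p : S.carrier), ∃ f : (⟨{p}ᶜ, isOpen_compl_singleton⟩ : TopologicalSpace.Opens S.carrier) → EuclideanSpace ℝ (Fin 4), Manifold.IsSmoothEmbedding (𝓡 4) (𝓡 4) ∞ f) ∧ Literature.Topology.FourManifolds.SmoothSchoenfliesConjectureFour) → SmoothPoincare4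

-- records of items no longer active in this route (dropped / restated):
-- earlier Assembly2 (stmt-SmoothPoincare4-0445, dropped 2026-08-16T14:43:05Z): moot by None — (∀ [Fact (Literature.Topology.FourManifolds.isSmoothEmbedding_sphereInclusion' 3)] (φ : (Metric.sphere (0 : EuclideanSpace ℝ (Fin 4)) 1) ≃ₘ⟮𝓡 3, 𝓡 3⟯ (Metric.sphere (0 : EuclideanSpace ℝ (Fin 4)) 1)) (T : Literature.Topology.FourManifolds.TwistedSphere 3 φ), Nonempty (T.carrier ≃ₘ⟮𝓡 4, 𝓡 4⟯ Metric.sphere (0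
-- earlier Assembly3 (stmt-SmoothPoincare4-0517, dropped 2026-08-16T14:43:05Z): proved by Literature.SPC4.schsplit_assembly_v3 — Literature.Topology.FourManifolds.isSmoothEmbedding_sphereInclusion' 3 → (∀ [Fact (Literature.Topology.FourManifolds.isSmoothEmbedding_sphereInclusion' 3)] (φ : (Metric.sphere (0 : EuclideanSpace ℝ (Fin 4)) 1) ≃ₘ⟮𝓡 3, 𝓡 3⟯ (Metric.sphere (0 : EuclideanSpace ℝ (Fin 4)) 1)) (

/-! D-0027 §2.1 — DECIDING THEOREM (planner-authored via `route open/edit --closes-file`; by planner-rchoice-SmoothPoincare4-SchoenfliesSpl-acbc1044-g2-0 2026-08-16T04:13:37Z):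
its hypotheses are this route's items and its conclusion the sub-problem Statement (glue_lint), and it elaborates with this file. -/

@[closes "route-SmoothPoincare4-SchoenfliesSplit"] theorem closes (hA : SchsplitPuncturedEmbeds) (hCap : SchsplitShellCap)
    (hBridge : SchsplitCapBridge) : _root_.SmoothPoincare4 :=
  _root_.Literature.SPC4.smoothPoincare4_of_forall_homotopySphere
    _root_.Literature.Topology.FourManifolds.compactSpace_of_homotopyEquiv_sphere_four_holds
    _root_.Literature.Topology.FourManifolds.isOrientable_of_homotopyEquiv_sphere_four_holds
    (hBridge hA hCap)

end Summit.SmoothPoincare4.SmoothPoincare4.Theses.SchoenfliesSplit
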